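import Summits.QuantumAdvantage.QuantumAdvantage.Theorems.SosSandwichThm7iiiOfAAQ
import Literature.Computability.QuantumComplexity.AaronsonAmbainisThm23Machine
import HarnessLib

/-!
# Aaronson–Ambainis Thm. 7 (iii) from the AA conjecture for QUERY algorithms — the machine half discharged

Support theorem for route `SosSandwich` (crux `PseudoBoundedAA`, stmt-QuantumAdvantage-15237): the hypothesis `hmach` of
`Theorems/SosSandwichThm7iiiOfAAQ.lean` is the tree's theorem `Thm23Machine.thm23_machine`
(`Literature/Computability/QuantumComplexity/AaronsonAmbainisThm23Machine.lean`: under `P = P^{#P}` every uniform Clifford+T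
oracle family has a polynomial-time transcript machine computing `[simTreeOn c 2^{-k} F x ≥ 1/2]`; it does not use the
conjecture).  Hence **`thm7iii_of_aaQuery : AA_Q → P = PSharpP → ∀ᵐ A ∂randomOracleMeasure, BQP^A ⊆ AvgP^A`** — Aaronson–Ambainis'
Thm. 7 (iii) with Conjecture 6 weakened to its quantum-query case (`AA_Q`, the even-degree case of Escudero Gutiérrez'
Conjecture 1.5) — and the barrier reading `P_ne_PSharpP_of_randomOracle_separation_of_aaQuery`.  Kept in its own file only
because of the size of the machine module's import closure.  Honest label: calibration; `AA_Q` open.  No named fact.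
Sources: AaronsonAmbainis2014 Thm. 7 (iii), Thm. 23 (proof, p. 14); EscuderoGutierrez2023 Thm. 1.4, Conj. 1.5.
-/

noncomputable section
-- D-0017: single-conjunct summit ⇒ the duplicate `QuantumAdvantage.QuantumAdvantage` is mandated.
set_option linter.dupNamespace false

namespace Summit.QuantumAdvantage.QuantumAdvantage.Theorems.SosSandwich.QueryCrux

open MeasureTheory _root_.Computability Literature.Computability.Complexity Literature.Computability.Complexity.Classes
  Literature.Computability.Cryptography Literature.Computability.QuantumComplexity Literature.Barriers.QuantumAdvantage

/-- **Aaronson–Ambainis 2014, Thm. 7 (iii), from `AA_Q`**: if the Aaronson–Ambainis influence bound holds for the acceptance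
probabilities of quantum QUERY algorithms and `P = P^{#P}`, then `BQP^A ⊆ AvgP^A` with probability `1` for a random oracle `A`
(the tree's `aaronsonAmbainis2014_thm7iii_holds` assumes the full conjecture for all bounded low-degree polynomials).
[cite: AaronsonAmbainis2014, Thm. 7 (iii), Thm. 23] -/
theorem thm7iii_of_aaQuery
    (hAAQ : ∃ (c : ℕ) (C : ℝ), 0 < C ∧ ∀ (N : ℕ) (Q : QQueryAlg N) (p : MvPolynomial (Fin N) ℝ) (ε : ℝ),
      1 ≤ Q.queries → (∀ x, evalBool p x = Q.acceptProb x) → 0 < ε → ε ≤ boolVariance p →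
        ∃ i : Fin N, C * (ε / Q.queries) ^ c ≤ influence i p)
    (hP : P = PSharpP) :
    ∀ᵐ A ∂randomOracleMeasure,
      BQPRel (A : Language Bool) ⊆ Literature.Computability.Complexity.AvgPRel (Oracle.ofLanguage (A : Language Bool)) :=
  thm7iii_of_aaQuery_of_machines (fun c k hP' _ hU => Thm23Machine.thm23_machine c k hP' hU) hAAQ hP

/-- **The barrier reading, from `AA_Q`** (twin of `P_ne_PSharpP_of_randomOracle_separation`): granted the Aaronson–Ambainis
bound for quantum query acceptance probabilities, an almost-sure random-oracle separation of `BQP` from `AvgP` refutes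
`P = P^{#P}`. [cite: AaronsonAmbainis2014, §1 (p. 5) and Thm. 7 (iii)] -/
theorem P_ne_PSharpP_of_randomOracle_separation_of_aaQuery
    (hAAQ : ∃ (c : ℕ) (C : ℝ), 0 < C ∧ ∀ (N : ℕ) (Q : QQueryAlg N) (p : MvPolynomial (Fin N) ℝ) (ε : ℝ),
      1 ≤ Q.queries → (∀ x, evalBool p x = Q.acceptProb x) → 0 < ε → ε ≤ boolVariance p →
        ∃ i : Fin N, C * (ε / Q.queries) ^ c ≤ influence i p)
    (hsep : ¬ ∀ᵐ A ∂randomOracleMeasure,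
      BQPRel (A : Language Bool) ⊆ Literature.Computability.Complexity.AvgPRel (Oracle.ofLanguage (A : Language Bool))) :
    P ≠ PSharpP :=
  fun hP => hsep (thm7iii_of_aaQuery hAAQ hP)

end Summit.QuantumAdvantage.QuantumAdvantage.Theorems.SosSandwich.QueryCrux
end
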